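import Literature.NumberTheory.Weil1964.AdelicSecondDegreeCharacter
import Literature.Analysis.Distribution.SchwartzFourierBilinForm
import Literature.Analysis.Distribution.SchwartzUniformTemperateFamily
import Literature.Analysis.Distribution.SchwartzEnvelope
import HarnessLib

/-!
# One Schwartz dominant for the Fourier transforms of a compact family of archimedean chirps `𝐞(-q_{βT₀}) · Ψ`

Topic `NumberTheory/Weil1964`; namespace `Literature.NumberTheory.Weil1964` (§2–§3) after a generic §1 in
`Literature.Analysis.Distribution`.  PROOF file (theorems only; no definition, no instance, no notation, no named fact, no `sorry`).
Cell `hodgecm-mathlib` FLOOR 0, crux H413, E-2 ∕ SW2 identity road, row (G3) «dominated families», ARCHIMEDEAN HALF of letter (G3-C)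
(B-p12 (g19) census §(G3-C); F0P4-plan (g3) 01:48:54Z (3); B-p09 (g18)).  HC_CM is proved only modulo the printed citations until rung 0
closes — nothing here bears on a summit statement.

For a number field `F`, `T₀ ∈ M_n(F ⊗ ℝ)`, a Schwartz function `Ψ` on `(F ⊗ ℝ)ⁿ`, a COMPACT set `K ⊆ F ⊗ ℝ` of archimedean parameters
and an additive Haar measure `μ`, the trace-pairing Fourier transforms of the chirped functions `𝐞(-q_{β T₀}) Ψ = t(βT₀)Ψ`
(★ `archSdChar`, `archSdCharCLM`), `β ∈ K`, are dominated by ONE non-negative Schwartz function (`(Φ₁ η).re`, `Φ₁` real-valued):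

* §1 `exists_fourierBilinFormCLM` — the CLM form of ★ `SchwartzMap.exists_eq_integral_fourierChar_bilinForm`: for a non-degenerate
  bilinear form `B` and a Haar measure `μ` there is a continuous linear `𝓕_B : 𝓢(E, F') →L[ℂ] 𝓢(E, F')` with
  `𝓕_B f w = ∫ 𝐞(-B(v, w)) f(v) dμ(v)` (`c · (𝓕 (f ∘ T⁻¹)) ∘ S`);
* §2 **`uniform_archSdChar_smul`** — the chirps `a ↦ 𝐞(-q_{βT₀}(a))`, `β` in a bounded set, form a UNIFORMLY TEMPERATE family
  (★ `uniform_slice_of_hasTemperateGrowth` for the temperate phase `(β, a) ↦ ⟨a, a(βT₀)⟩` on `(F ⊗ ℝ) × (F ⊗ ℝ)ⁿ` and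
  ★ `uniform_comp_of_bounded_derivs` for `s ↦ 𝐞(s)`, `|𝐞^{(i)}| ≤ (2π)^i`);
* §3 **`exists_schwartz_dominating_fourier_archSdChar_family`** — the dominant (★ `exists_seminorm_smulLeftCLM_le_uniform` ⇒ uniform
  seminorms of `t(βT₀)Ψ`; ★ `exists_forall_norm_mul_pow_le_of_uniform` for `𝓕_B` ⇒ uniform rapid decay; ★ B-p12's
  `exists_schwartz_complex_forall_norm_le_of_uniform_rapid_decay` ⇒ the envelope).

## References
* A. Weil, *Sur certains groupes d'opérateurs unitaires*, Acta Math. 111 (1964), Chap. III n° 41, Lemme 5 (p. 194) (one dominant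
  for a compact family). [Weil1964]
* L. Hörmander, *The Analysis of Linear Partial Differential Operators I* (1990), §7.1. [HormanderALPDO1]
-/

noncomputable section

open scoped SchwartzMap ContDiff FourierTransform Matrix Classical
open MeasureTheory NumberField NumberField.mixedEmbedding Function

namespace Literature.Analysis.Distribution

/-! ## §1 The trace-pairing (bilinear-form) Fourier transform as a continuous linear map -/

section FourierBilin

variable {E : Type*} [NormedAddCommGroup E] [NormedSpace ℝ E] [FiniteDimensional ℝ E] [MeasurableSpace E] [BorelSpace E]
  {F' : Type*} [NormedAddCommGroup F'] [NormedSpace ℂ F']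

/-- **The Fourier transform for a non-degenerate bilinear form and a Haar measure is a continuous linear endomorphism of `𝓢`**:
there is `𝓕_B : 𝓢(E, F') →L[ℂ] 𝓢(E, F')` with `𝓕_B f w = ∫ 𝐞(-B(v, w)) f(v) dμ(v)` — `c · S^* ∘ 𝓕 ∘ (T⁻¹)^*` for `B(v, w) = ⟪Tv, Sw⟫`,
`T_* μ = c · vol` (the CLM form of ★ `exists_eq_integral_fourierChar_bilinForm`). [cite: HormanderALPDO1, §7.1] -/
theorem exists_fourierBilinFormCLM (μ : Measure E) [μ.IsAddHaarMeasure] (B : LinearMap.BilinForm ℝ E)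
    (hB : B.Nondegenerate) :
    ∃ 𝓕B : 𝓢(E, F') →L[ℂ] 𝓢(E, F'), ∀ (f : 𝓢(E, F')) (w : E), 𝓕B f w = ∫ v, 𝐞 (-(B v w)) • f v ∂μ := by
  obtain ⟨T, S, hTS⟩ := exists_continuousLinearEquiv_bilinForm_eq_inner B hB
  set V := EuclideanSpace ℝ (Fin (Module.finrank ℝ E)) with hV
  set c : NNReal := (μ.map T).addHaarScalarFactor (volume : Measure V) with hc
  have hμ : μ.map T = c • (volume : Measure V) := Measure.isAddLeftInvariant_eq_smul _ _
  refine ⟨(c : ℂ) • ((SchwartzMap.compCLMOfContinuousLinearEquiv ℂ S).comp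
      ((SchwartzMap.fourierTransformCLM ℂ).comp (SchwartzMap.compCLMOfContinuousLinearEquiv ℂ T.symm))),
    fun f w => ?_⟩
  have hchange : ∫ v, 𝐞 (-(B v w)) • f v ∂μ = ∫ x : V, 𝐞 (-inner ℝ x (S w)) • f (T.symm x) ∂(μ.map T) := by
    rw [show (⇑T : E → V) = ⇑T.toHomeomorph.toMeasurableEquiv by
      rw [Homeomorph.toMeasurableEquiv_coe]; rfl, integral_map_equiv]
    refine integral_congr_ae (Filter.Eventually.of_forall fun v => ?_)
    simp only [Homeomorph.toMeasurableEquiv_coe, ContinuousLinearEquiv.coe_toHomeomorph,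
      ContinuousLinearEquiv.symm_apply_apply, hTS]
  rw [hchange, hμ, integral_smul_nnreal_measure, _root_.smul_apply, _root_.smul_apply,
    ContinuousLinearMap.comp_apply, ContinuousLinearMap.comp_apply, SchwartzMap.compCLMOfContinuousLinearEquiv_apply,
    Function.comp_apply, SchwartzMap.fourierTransformCLM_apply, SchwartzMap.fourier_coe, Real.fourier_eq,
    NNReal.smul_def, ← Complex.coe_smul]
  rfl

end FourierBilin

end Literature.Analysis.Distribution

namespace Literature.NumberTheory.Weil1964

open Literature.Analysis.Distribution Literature.NumberTheory.Automorphic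

variable (F : Type) [Field F] [NumberField F] {n : ℕ}

/-! ## §2 The chirps `𝐞(-q_{βT₀})`, `β` bounded, are uniformly temperate -/

/-- **The phase `(β, a) ↦ ⟨a, a(βT₀)⟩ = q_{βT₀}(a)` has temperate growth on `(F ⊗ ℝ) × (F ⊗ ℝ)ⁿ`** (trilinear; Mathlib
`ContinuousLinearMap.bilinear_hasTemperateGrowth` twice). [cite: HormanderALPDO1, §7.1] -/
theorem hasTemperateGrowth_archSdForm_smul (T₀ : Matrix (Fin n) (Fin n) (mixedSpace F)) :
    (fun p : mixedSpace F × (Fin n → mixedSpace F) => archSdForm F (p.1 • T₀) p.2).HasTemperateGrowth := by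
  set L : mixedSpace F →L[ℝ] (Fin n → mixedSpace F) →L[ℝ] (Fin n → mixedSpace F) :=
    ContinuousLinearMap.lsmul ℝ (mixedSpace F) with hL
  have heq : (fun p : mixedSpace F × (Fin n → mixedSpace F) => archSdForm F (p.1 • T₀) p.2) =
      fun p => piTracePairingCLM F n (ContinuousLinearMap.snd ℝ (mixedSpace F) (Fin n → mixedSpace F) p)
        (L (ContinuousLinearMap.fst ℝ (mixedSpace F) (Fin n → mixedSpace F) p)
          (vecMulArchCLM F T₀ (ContinuousLinearMap.snd ℝ (mixedSpace F) (Fin n → mixedSpace F) p))) := by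
    funext p
    change piTracePairing F (Fin n) p.2 (p.2 ᵥ* (p.1 • T₀)) = piTracePairing F (Fin n) p.2 (p.1 • (p.2 ᵥ* T₀))
    rw [Matrix.vecMul_smul]
  rw [heq]
  exact (piTracePairingCLM F n).bilinear_hasTemperateGrowth
    (ContinuousLinearMap.snd ℝ (mixedSpace F) (Fin n → mixedSpace F)).hasTemperateGrowth
    (L.bilinear_hasTemperateGrowth (ContinuousLinearMap.fst ℝ (mixedSpace F) (Fin n → mixedSpace F)).hasTemperateGrowth
      ((vecMulArchCLM F T₀).hasTemperateGrowth.comp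
        (ContinuousLinearMap.snd ℝ (mixedSpace F) (Fin n → mixedSpace F)).hasTemperateGrowth))

/-- The derivatives of `s ↦ 𝐞(s)` are bounded by `(2π)^N` up to order `N`. [folklore] -/
private theorem fourierChar_derivs_bounded (N : ℕ) :
    ∃ M : ℝ, 0 ≤ M ∧ ∀ i ≤ N, ∀ y : ℝ, ‖iteratedFDeriv ℝ i (fun s : ℝ => ((𝐞 s : Circle) : ℂ)) y‖ ≤ M := by
  refine ⟨(2 * Real.pi) ^ N, by positivity, fun i hi y => ?_⟩
  rw [norm_iteratedFDeriv_eq_norm_iteratedDeriv, iteratedDeriv_fourierChar_coe, norm_mul, norm_pow, norm_two_pi_mul_I,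
    Circle.norm_coe, mul_one]
  exact pow_le_pow_right₀ (by linarith [Real.pi_gt_three]) hi

/-- **The archimedean chirps `a ↦ 𝐞(-q_{βT₀}(a))`, `β` in a BOUNDED set, form a uniformly temperate family** (smooth, and for every
`N` one pair `(l, C)` bounds all derivatives of order `≤ N` of all members by `C (1 + ‖a‖)^l`). [cite: Weil1964, Chap. III n° 41, Lemme 5 (p. 194)]
[cite: HormanderALPDO1, §7.1] -/
theorem uniform_archSdChar_smul (T₀ : Matrix (Fin n) (Fin n) (mixedSpace F)) {K : Set (mixedSpace F)} {R : ℝ} (hR : 0 ≤ R)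
    (hK : ∀ β ∈ K, ‖β‖ ≤ R) :
    (∀ β ∈ K, ContDiff ℝ ∞ (archSdChar F (β • T₀))) ∧
      ∀ N : ℕ, ∃ (l : ℕ) (C : ℝ), 0 ≤ C ∧ ∀ β ∈ K, ∀ m ≤ N, ∀ a : Fin n → mixedSpace F,
        ‖iteratedFDeriv ℝ m (archSdChar F (β • T₀)) a‖ ≤ C * (1 + ‖a‖) ^ l := by
  -- slices of the negated phase
  have hneg : (fun p : mixedSpace F × (Fin n → mixedSpace F) => -archSdForm F (p.1 • T₀) p.2).HasTemperateGrowth :=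
    (hasTemperateGrowth_archSdForm_smul F T₀).neg
  obtain ⟨hs, hb⟩ := uniform_slice_of_hasTemperateGrowth (ψ := fun p : mixedSpace F × (Fin n → mixedSpace F) =>
    -archSdForm F (p.1 • T₀) p.2) hneg hR hK
  -- compose with `𝐞`
  obtain ⟨hs', hb'⟩ := uniform_comp_of_bounded_derivs (S := K) contDiff_fourierChar_coe fourierChar_derivs_bounded
    (ψ := fun (β : mixedSpace F) (a : Fin n → mixedSpace F) => -archSdForm F (β • T₀) a) hs hb
  have hfun : ∀ β : mixedSpace F, archSdChar F (β • T₀) =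
      (fun s : ℝ => ((𝐞 s : Circle) : ℂ)) ∘ fun a : Fin n → mixedSpace F => -archSdForm F (β • T₀) a := fun β => rfl
  refine ⟨fun β hβ => (hfun β).symm ▸ hs' β hβ, fun N => ?_⟩
  obtain ⟨l, C, hC, h⟩ := hb' N
  exact ⟨l, C, hC, fun β hβ m hm a => (hfun β).symm ▸ h β hβ m hm a⟩

/-! ## §3 One Schwartz dominant for the Fourier transforms of the chirped family -/

/-- **ONE SCHWARTZ DOMINANT FOR `{𝓕_μ[𝐞(-q_{βT₀}) Ψ] : β ∈ K}`, `K` COMPACT** (archimedean half of the (G3-C) letter): for a Haar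
measure `μ` on `(F ⊗ ℝ)ⁿ`, `T₀ ∈ M_n(F ⊗ ℝ)`, `Ψ ∈ 𝓢((F ⊗ ℝ)ⁿ, ℂ)` and a compact `K ⊆ F ⊗ ℝ` there is a real-valued non-negative
Schwartz function `Φ₁` with `‖∫ 𝐞(-⟨a, η⟩) · 𝐞(-q_{βT₀}(a)) Ψ(a) dμ(a)‖ ≤ Φ₁(η)` for all `β ∈ K` and all `η`.
[cite: Weil1964, Chap. III n° 41, Lemme 5 (p. 194)] [cite: HormanderALPDO1, §7.1] -/
theorem exists_schwartz_dominating_fourier_archSdChar_family [MeasurableSpace (Fin n → mixedSpace F)]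
    [BorelSpace (Fin n → mixedSpace F)] (μ : Measure (Fin n → mixedSpace F)) [μ.IsAddHaarMeasure]
    (T₀ : Matrix (Fin n) (Fin n) (mixedSpace F)) {K : Set (mixedSpace F)} (hK : IsCompact K)
    (Ψ : 𝓢((Fin n → mixedSpace F), ℂ)) :
    ∃ Φ₁ : 𝓢((Fin n → mixedSpace F), ℂ), (∀ η, (Φ₁ η).im = 0 ∧ 0 ≤ (Φ₁ η).re) ∧
      ∀ β ∈ K, ∀ η : Fin n → mixedSpace F,
        ‖∫ a, 𝐞 (-(piTracePairing F (Fin n) a η)) • (archSdChar F (β • T₀) a * Ψ a) ∂μ‖ ≤ (Φ₁ η).re := by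
  -- `K` is bounded
  obtain ⟨R₀, hR₀⟩ := hK.isBounded.exists_norm_le
  set R : ℝ := max R₀ 0 with hR_def
  have hR : 0 ≤ R := le_max_right _ _
  have hKR : ∀ β ∈ K, ‖β‖ ≤ R := fun β hβ => (hR₀ β hβ).trans (le_max_left _ _)
  -- the chirps are uniformly temperate ⇒ uniform seminorm bounds for `t(βT₀)Ψ`
  obtain ⟨hsm, hbd⟩ := uniform_archSdChar_smul F T₀ hR hKR
  have hfam : ∀ m : ℕ × ℕ, ∃ M : ℝ, ∀ β ∈ K, SchwartzMap.seminorm ℂ m.1 m.2 (archSdCharCLM F (β • T₀) Ψ) ≤ M := by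
    intro m
    obtain ⟨s, C', -, hb⟩ := exists_seminorm_smulLeftCLM_le_uniform (𝕜 := ℂ) (E := ℂ)
      (g := fun (β : mixedSpace F) => archSdChar F (β • T₀)) hsm hbd m.1 m.2
    exact ⟨C' * (s.sup (schwartzSeminormFamily ℂ (Fin n → mixedSpace F) ℂ)) Ψ, fun β hβ => hb β hβ Ψ⟩
  -- transport through the trace-pairing Fourier CLM ⇒ uniform rapid decay
  obtain ⟨𝓕B, h𝓕B⟩ := exists_fourierBilinFormCLM (F' := ℂ) μ (piTracePairing F (Fin n)) (piTracePairing_nondegenerate F (Fin n))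
  have hdecay : ∀ N : ℕ, ∃ C : ℝ, ∀ β ∈ K, ∀ η : Fin n → mixedSpace F,
      ‖∫ a, 𝐞 (-(piTracePairing F (Fin n) a η)) • (archSdChar F (β • T₀) a * Ψ a) ∂μ‖ * (1 + ‖η‖) ^ N ≤ C := by
    intro N
    obtain ⟨C, hC⟩ := exists_forall_norm_mul_pow_le_of_uniform (𝕜 := ℂ) 𝓕B
      (f := fun β : mixedSpace F => archSdCharCLM F (β • T₀) Ψ) hfam N
    refine ⟨C, fun β hβ η => ?_⟩
    have h1 := hC β hβ η
    rw [h𝓕B] at h1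
    have h2 : (fun a => 𝐞 (-(piTracePairing F (Fin n) a η)) • (archSdCharCLM F (β • T₀) Ψ) a) =
        fun a => 𝐞 (-(piTracePairing F (Fin n) a η)) • (archSdChar F (β • T₀) a * Ψ a) := by
      funext a
      rw [archSdCharCLM_apply]
    rw [h2] at h1
    rwa [mul_comm] at h1
  -- the envelope
  exact exists_schwartz_complex_forall_norm_le_of_uniform_rapid_decay
    (F := fun (β : mixedSpace F) (η : Fin n → mixedSpace F) =>
      ∫ a, 𝐞 (-(piTracePairing F (Fin n) a η)) • (archSdChar F (β • T₀) a * Ψ a) ∂μ) hdecay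

end Literature.NumberTheory.Weil1964

end
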